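import Summits.ResolutionOfSingularities.ResolutionOfSingularities.Theorems.AbsoluteContactHasseRing
import HarnessLib

/-!
# AbsoluteContactHasse — decomp-res node «AbsoluteGiraud» (lens-6 g16), tree file 4/7: §3a (continued)
local-ring and scheme level of the
separable-residue Hasse lemma, and §3 THE PORT TURNED THEOREM `hsPortSepResidue : HSPortSepResidue` with its
consequence `noSepCoreOff3_of_port`
(no core point at marking 3 with separable residue field, `p ≠ 3`).  PROVED.

Content VERBATIM from the decomp-res lens-6 g16 file `HOME/decomp-res-lens-6/g16/AbsoluteGiraud.lean` (sha256
bc25b5879a7322cd; CRITIC-LEDGER row 118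
CLEARED: MAP +1; it SUPERSEDES g15 `AbsoluteContact.lean` cca8a261, rows 110–112, whose §1–§5 are
byte-identical).  HOME = run/shared/lean/pub/decomp-res.
Host: route `MaxContactCut`, aside 31574 `PVPureGame` through the lens-6 chain SatelliteExit (tree
`Theorems/SatelliteExitClasses`) → g12–g14
BoundaryValve / SwitchExclusion / MemberCalculus (HOME, critic rows 87/93/103; not yet in the tree) → the scope
class `AllHug3Off3` (§1 here).

[WRITER NOTE (decomp-res writer g6): the lens file is split into `AbsoluteContactScope` (§0 g12 vocabulary over the
landed `Branch` + §1 the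
scope class and the perfect half) → `AbsoluteContactPrimitives` (§2, landed earlier) →
`AbsoluteContactHasseRing` / `AbsoluteContactHasse` (§3a/§3
the separable-residue Hasse lemma IN KERNEL) → `AbsoluteContactAxes` (§4/§5 the two axes: residue field of the
root point; absolute contact) →
`AbsoluteGiraudKernel` (§6 scheme-level Giraud persistence of absolute contact under one blowing up) →
`AbsoluteGiraudBranch` (§7 `absGiraud3`,
§8 assembly).  The two Theses-cone imports of the lens file (`Theses.MaxContactCut`, `MaxContactCutPurityValve`)
are unused and dropped, so every
file is route-importable; `set_option` lines dropped; nothing else changed.]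
(Sources: Giraud1975; EncinasVillamayor2000 Thm. 4.9; BravoGarciaEscamillaVillamayor2012 Lemma 4.6;
VillamayorU2008ReesDiff §4; CossartPiltant2008 §2; CossartJannsenSaito2020.)
-/

noncomputable section

open CategoryTheory AlgebraicGeometry TopologicalSpace
open Literature.AlgebraicGeometry.Resolution
open Summit.ResolutionOfSingularities.ResolutionOfSingularities.Theorems
open WeakOrderReduction ForcedTowerClasses PurityValveClasses
open SatelliteExitClasses

namespace Summit.ResolutionOfSingularities.ResolutionOfSingularities.Theorems.AbsoluteContactClasses

section HasseSep

open IsLocalRing MvPowerSeries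

universe u v w

section Local

/-- **Stacks 00TV at a local ring**: a regular local ring essentially of finite type over a field `k` whose residue field is a
separable (algebraic) extension of `k` is formally smooth over `k`. The tree's
`formallySmooth_of_isRegularLocalRing_of_perfectField`
with perfectness replaced by residue separability, via the tree's
`isSmoothAt_of_isRegularLocalRing_of_formallySmooth_residueField`. (Sources: StacksProject, Tag 00TV; Matsumura1987,
§30 Remark 2 after Thm. 30.3.) -/
theorem formallySmooth_of_isRegularLocalRing_of_isSeparable_residueField (k A : Type u) [Field k] [CommRing A] [Algebra k A]
    [Algebra.EssFiniteType k A] [IsRegularLocalRing A] [Algebra.IsSeparable k (ResidueField A)] :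
    Algebra.FormallySmooth k A := by
  -- `A` is a localization of the finitely generated subalgebra `B`
  let B : Subalgebra k A := Algebra.EssFiniteType.subalgebra k A
  let M : Submonoid B := (IsUnit.submonoid A).comap (algebraMap B A)
  haveI hM : IsLocalization M A := Algebra.EssFiniteType.isLocalization k A
  let q : Ideal B := (maximalIdeal A).comap (algebraMap B A)
  haveI hq : q.IsPrime := Ideal.comap_isPrime _ _
  have hMq : M = q.primeCompl := by
    ext b
    simp only [M, q, Submonoid.mem_comap, IsUnit.mem_submonoid_iff, Ideal.mem_primeCompl_iff,
      Ideal.mem_comap, mem_maximalIdeal, mem_nonunits_iff, not_not]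
  haveI : IsLocalization q.primeCompl A := by rw [← hMq]; exact hM
  let e : Localization.AtPrime q ≃ₐ[B] A :=
    IsLocalization.algEquiv q.primeCompl (Localization.AtPrime q) A
  haveI : IsRegularLocalRing (Localization.AtPrime q) :=
    IsRegularLocalRing.of_ringEquiv e.toRingEquiv.symm
  haveI : Algebra.FinitePresentation k B := Algebra.FinitePresentation.of_finiteType.mp inferInstance
  -- the residue fields of `B_q` and `A` agree (as `k`-algebras)
  let ek : Localization.AtPrime q ≃ₐ[k] A := e.restrictScalars k
  have hcomm : ∀ c : k, IsLocalRing.ResidueField.mapEquiv ek.toRingEquiv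
      (algebraMap k (ResidueField (Localization.AtPrime q)) c) = algebraMap k (ResidueField A) c := by
    intro c
    rw [IsScalarTower.algebraMap_apply k (Localization.AtPrime q) (ResidueField (Localization.AtPrime q)),
      IsScalarTower.algebraMap_apply k A (ResidueField A), ResidueField.algebraMap_eq, ResidueField.algebraMap_eq,
      ResidueField.mapEquiv_apply]
    change ResidueField.map (ek.toRingEquiv : Localization.AtPrime q →+* A) _ = _
    rw [ResidueField.map_residue]
    congr 1
    exact ek.commutes c
  let eκ : ResidueField (Localization.AtPrime q) ≃ₐ[k] ResidueField A := AlgEquiv.ofRingEquiv hcomm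
  haveI : Algebra.FormallyEtale k (ResidueField A) := Algebra.FormallyEtale.of_isSeparable k (ResidueField A)
  haveI : Algebra.FormallySmooth k (ResidueField (Localization.AtPrime q)) := Algebra.FormallySmooth.of_equiv eκ.symm
  have hsm : Algebra.IsSmoothAt k q := isSmoothAt_of_isRegularLocalRing_of_formallySmooth_residueField k B q
  exact Algebra.FormallySmooth.of_equiv ek

end Local

section Scheme

variable {K : Type u} [Field K] {Z : Scheme.{u}} (f : Z ⟶ Spec (.of K))

/-- The tree's `k`-structure on a stalk (`stalkHom`: `K → Γ(Z,𝒪_Z) → 𝒪_{Z,ξ}`) is the stalk map of `f` composed with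
`K → 𝒪_{Spec K, f ξ}`. [folklore] -/
theorem stalkMap_comp_toStalk_eq_stalkHom (ξ : Z) :
    (f.stalkMap ξ).hom.comp (StructureSheaf.toStalk K (f ξ)).hom =
      stalkHom (f.appTop.hom.comp (Scheme.ΓSpecIso (.of K)).inv.hom) ξ := by
  ext c
  simp only [RingHom.comp_apply, stalkHom]
  rw [StructureSheaf.toStalk, Scheme.ΓSpecIso_inv]
  simp only [CommRingCat.hom_comp, CommRingCat.hom_ofHom]
  erw [Scheme.Hom.germ_stalkMap_apply f ⊤ ξ trivial]
  rfl

/-- **A regular point with separable residue field of a scheme locally of finite type over a field lies in the smooth locus**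
(Stacks 00TV at a point; residue separability for the tree's `k`-structure `stalkAlgebra`). (Sources: StacksProject,
Tag 00TV.) -/
theorem mem_smoothLocus_of_isRegularLocalRing_of_isSeparable [LocallyOfFiniteType f] (ξ : Z)
    (hreg : IsRegularLocalRing (Z.presheaf.stalk ξ))
    (hsep : letI := stalkAlgebra (f.appTop.hom.comp (Scheme.ΓSpecIso (.of K)).inv.hom) ξ
      Algebra.IsSeparable K (ResidueField (Z.presheaf.stalk ξ))) :
    haveI : LocallyOfFinitePresentation f := LocallyOfFinitePresentation.iff_locallyOfFiniteType.mpr inferInstance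
    ξ ∈ f.smoothLocus := by
  haveI : LocallyOfFinitePresentation f := LocallyOfFinitePresentation.iff_locallyOfFiniteType.mpr inferInstance
  rw [Scheme.Hom.mem_smoothLocus]
  let R := (Spec (CommRingCat.of K)).presheaf.stalk (f ξ)
  let S := Z.presheaf.stalk ξ
  letI algRS : Algebra R S := (f.stalkMap ξ).hom.toAlgebra
  letI algkR : Algebra K R := StructureSheaf.stalkAlgebra (↑(CommRingCat.of K)) (f ξ)
  haveI : IsLocalization.AtPrime R (f ξ).asIdeal :=
    StructureSheaf.IsLocalization.to_stalk (↑(CommRingCat.of K)) (f ξ)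
  haveI : Algebra.FormallyEtale K R := Algebra.FormallyEtale.of_isLocalization (f ξ).asIdeal.primeCompl
  haveI : Algebra.EssFiniteType K R := Algebra.EssFiniteType.of_isLocalization R (f ξ).asIdeal.primeCompl
  letI algkS : Algebra K S := stalkAlgebra (f.appTop.hom.comp (Scheme.ΓSpecIso (.of K)).inv.hom) ξ
  haveI : IsScalarTower K R S :=
    IsScalarTower.of_algebraMap_eq' (stalkMap_comp_toStalk_eq_stalkHom f ξ).symm
  haveI : Algebra.EssFiniteType R S := LocallyOfFiniteType.stalkMap f ξ
  haveI : Algebra.EssFiniteType K S := Algebra.EssFiniteType.comp K R S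
  haveI : IsRegularLocalRing S := hreg
  haveI : Algebra.IsSeparable K (ResidueField S) := hsep
  have hkS : Algebra.FormallySmooth K S := formallySmooth_of_isRegularLocalRing_of_isSeparable_residueField K S
  exact (Algebra.FormallySmooth.iff_restrictScalars (R := K) (A := R) (B := S)).mp hkS

/-- **Linear-part criterion at a point of the smooth locus with separable residue field** (the tree's
`exists_isDiffOpLE_adicOrder_eq_one_stalk_of_smooth` with `PerfectField K`, `Smooth f` replaced by `ξ ∈ f.smoothLocus` and
`κ(ξ)/K` separable). (Sources: VillamayorU2008ReesDiff, §4.1 and Remark 4.3; EGAIV4, §16.8, Thm. 16.11.2 and §17.) -/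
theorem exists_isDiffOpLE_adicOrder_eq_one_stalk_of_mem_smoothLocus (p : ℕ) [CharP K p] [LocallyOfFinitePresentation f]
    (ξ : Z) (hx : ξ ∈ f.smoothLocus) (hξ : IsClosed ({ξ} : Set Z))
    (hsep : letI := stalkAlgebra (f.appTop.hom.comp (Scheme.ΓSpecIso (.of K)).inv.hom) ξ
      Algebra.IsSeparable K (ResidueField (Z.presheaf.stalk ξ)))
    {N : ℕ} {h : Z.presheaf.stalk ξ}
    (h1 : h ∈ maximalIdeal (Z.presheaf.stalk ξ) ^ (N + 1)) (h2 : h ∉ maximalIdeal (Z.presheaf.stalk ξ) ^ (N + 2))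
    (hp : ¬ p ∣ N + 1) :
    letI := stalkAlgebra (f.appTop.hom.comp (Scheme.ΓSpecIso (.of K)).inv.hom) ξ
    ∃ D : Z.presheaf.stalk ξ →ₗ[K] Z.presheaf.stalk ξ, IsDiffOpLE K N D ∧ adicOrder (D h) = 1 := by
  classical
  set φ₀ : K →+* Γ(Z, ⊤) := f.appTop.hom.comp (Scheme.ΓSpecIso (.of K)).inv.hom with hφ₀
  letI := stalkAlgebra φ₀ ξ
  obtain ⟨d, ⟨U, hU⟩, ⟨V, hV⟩, hξV, e', hstd⟩ :=
    Literature.AlgebraicGeometry.Motives.exists_appLE_isStandardSmoothOfRelativeDimension_of_mem_smoothLocus f hx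
  have hUtop : U = ⊤ := by
    ext y
    simp only [Opens.coe_top, Set.mem_univ, iff_true]
    have : f ξ ∈ U := e' hξV
    rwa [Subsingleton.elim y (f ξ)]
  subst hUtop
  have hφ : sectionsHom φ₀ V =
      (f.appLE ⊤ V e').hom.comp (Scheme.ΓSpecIso (.of K)).commRingCatIsoToRingEquiv.symm.toRingHom := rfl
  have hφstd : (sectionsHom φ₀ V).IsStandardSmoothOfRelativeDimension d := by
    rw [hφ]
    exact RingHom.isStandardSmoothOfRelativeDimension_respectsIso.2 _ _ hstd
  obtain ⟨g, hgC, hgEt⟩ := RingHom.IsStandardSmoothOfRelativeDimension.exists_etale_mvPolynomial hφstd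
  letI : Algebra K Γ(Z, V) := sectionsAlgebra φ₀ V
  letI : Algebra (MvPolynomial (Fin d) K) Γ(Z, V) := g.toAlgebra
  haveI : IsScalarTower K (MvPolynomial (Fin d) K) Γ(Z, V) :=
    IsScalarTower.of_algebraMap_eq (R := K) (S := MvPolynomial (Fin d) K) (A := Γ(Z, V)) fun c => by
      show sectionsHom φ₀ V c = g (algebraMap K (MvPolynomial (Fin d) K) c)
      rw [MvPolynomial.algebraMap_eq, ← hgC]
      rfl
  haveI : Algebra.Etale (MvPolynomial (Fin d) K) Γ(Z, V) := hgEt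
  haveI : Algebra.FormallyEtale (MvPolynomial (Fin d) K) Γ(Z, V) := Algebra.Etale.formallyEtale
  haveI : Algebra.FinitePresentation (MvPolynomial (Fin d) K) Γ(Z, V) := Algebra.Etale.finitePresentation
  haveI : Algebra.FiniteType K Γ(Z, V) :=
    Algebra.FiniteType.trans (S := MvPolynomial (Fin d) K) inferInstance inferInstance
  letI : Algebra Γ(Z, V) (Z.presheaf.stalk ξ) := TopCat.Presheaf.algebra_section_stalk Z.presheaf ⟨ξ, hξV⟩
  haveI : IsLocalization.AtPrime (Z.presheaf.stalk ξ) (hV.primeIdealOf ⟨ξ, hξV⟩).asIdeal :=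
    hV.isLocalization_stalk ⟨ξ, hξV⟩
  haveI : (hV.primeIdealOf ⟨ξ, hξV⟩).asIdeal.IsMaximal := hV.primeIdealOf_isMaximal_of_isClosed ⟨ξ, hξV⟩ hξ
  haveI : IsScalarTower K Γ(Z, V) (Z.presheaf.stalk ξ) :=
    IsScalarTower.of_algebraMap_eq (R := K) (S := Γ(Z, V)) (A := Z.presheaf.stalk ξ) fun c => by
      show stalkHom φ₀ ξ c = (Z.presheaf.germ V ξ hξV).hom (sectionsHom φ₀ V c)
      rw [← germ_comp_sectionsHom φ₀ V ξ hξV]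
      rfl
  haveI : Algebra.IsSeparable K (ResidueField (Z.presheaf.stalk ξ)) := hsep
  exact exists_isDiffOpLE_adicOrder_eq_one_of_etaleCoordinates_of_isSeparable K (σ := Fin d) p
    (hV.primeIdealOf ⟨ξ, hξV⟩).asIdeal (Z.presheaf.stalk ξ) h1 h2 hp

end Scheme

end HasseSep

/-! ## §3 The separable-residue Hasse lemma (rev0: PORT; rev1: THEOREM `hsPortSepResidue`) and the separable slice:
no core points -/

/-- **`HSPortSepResidue`** (rev0: PORT; rev1: KERNEL-PROVED below, `hsPortSepResidue`) — the tree's PROVED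
linear-part criterion
`exists_isDiffOpLE_adicOrder_eq_one_stalk_of_smooth` with `[PerfectField K] [Smooth f]` replaced by «`Y` a base of
the class (regular,
of finite type), `y` closed with SEPARABLE residue field»: for `h ∈ 𝔪_y^{N+1} ∖ 𝔪_y^{N+2}` and `p ∤
N+1` some `k`-linear differential
operator of order `≤ N` of `𝒪_{Y,y}` takes `h` to an element of `𝔪_y`-adic order exactly `1`.  Regular +
separable residue field ⇒
formally smooth at `y` ([StacksProject 00TV] = [Matsumura1987] §30 Rem. 2, the separable form of the tree's
`formallySmooth_of_isRegularLocalRing_of_perfectField`); Cohen frame with `k`-linear coefficient field: tree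
`TaylorFrame.exists_of_isSeparable`; Hasse–Schmidt operators along the frame: [EGAIV4] §16.8, Thm 16.11.2,
§17.6. (Sources: EGAIV4, Thm. 16.11.2; Matsumura1987, §30 Remark 2 after Thm. 30.3.) -/
def HSPortSepResidue : Prop :=
  ∀ p : ℕ, p.Prime → ∀ (k : Type) [Field k] [CharP k p] (Y : Scheme.{0}) (g : Y ⟶ Spec (.of k)),
    IsBase Y g → ∀ (y : Y), IsClosed ({y} : Set Y) → SepResidueAt g y →
      ∀ (N : ℕ) (h : Y.presheaf.stalk y), h ∈ IsLocalRing.maximalIdeal (Y.presheaf.stalk y) ^ (N + 1) →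
        h ∉ IsLocalRing.maximalIdeal (Y.presheaf.stalk y) ^ (N + 2) → ¬ p ∣ N + 1 →
          letI := stalkAlgebra (g.appTop.hom.comp (Scheme.ΓSpecIso (.of k)).inv.hom) y
          ∃ D : Y.presheaf.stalk y →ₗ[k] Y.presheaf.stalk y, IsDiffOpLE k N D ∧ adicOrder (D h) = 1

/-- **kernel (PROVED, rev1) · the separable-residue Hasse lemma**: `HSPortSepResidue` holds — regular + separable
residue field ⇒ the
point lies in the smooth locus (`mem_smoothLocus_of_isRegularLocalRing_of_isSeparable`, Stacks 00TV via the tree),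
and on a standard-smooth
chart étale over affine space the Hasse–Schmidt operators adapted to the separable equations of the point give
the linear part
(`exists_isDiffOpLE_adicOrder_eq_one_stalk_of_mem_smoothLocus`). (Sources: StacksProject, Tag 00TV; EGAIV4, Thm. 16.11.2.) -/
theorem hsPortSepResidue : HSPortSepResidue := by
  intro p hp k _ _ Y g hB y hy hsep N h h1 h2 hpN
  haveI : LocallyOfFiniteType g := hB.locallyOfFiniteType
  haveI : LocallyOfFinitePresentation g := LocallyOfFinitePresentation.iff_locallyOfFiniteType.mpr inferInstance
  have hx : y ∈ g.smoothLocus := mem_smoothLocus_of_isRegularLocalRing_of_isSeparable g y (hB.isRegular y) hsep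
  exact exists_isDiffOpLE_adicOrder_eq_one_stalk_of_mem_smoothLocus g p y hx hy hsep h1 h2 hpN

/-- **kernel (PROVED mod PORT): Hasse contact at SEPARABLE-RESIDUE points over ANY field** — g14's
`isContactPt_of_idealOrder_eq_three`
with the smooth/perfect step replaced by the port. (Sources: VillamayorU2008ReesDiff, §4.1 and Remark 4.3.) -/
theorem isContactPt_of_idealOrder_eq_three_of_sep (hH : HSPortSepResidue) {p : ℕ} (hp : p.Prime) (hp3 : p ≠ 3)
    {k : Type} [Field k] [CharP k p] {Y : Scheme.{0}} (g : Y ⟶ Spec (.of k)) (hB : IsBase Y g) (I : Y.IdealSheafData)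
    {y : Y} (hy : IsClosed ({y} : Set Y)) (hsep : SepResidueAt g y) (hord : idealOrder I y = ((3 : ℕ) : ℕ∞)) :
    IsContactPt g I 3 y := by
  haveI : LocallyOfFiniteType g := hB.locallyOfFiniteType
  set φ : k →+* Γ(Y, ⊤) := g.appTop.hom.comp (Scheme.ΓSpecIso (.of k)).inv.hom with hφ
  have hft : HasFiniteTypeSections φ := hasFiniteTypeSections_of_locallyOfFiniteType k g
  have hle : stalkIdeal I y ≤ IsLocalRing.maximalIdeal (Y.presheaf.stalk y) ^ 3 := (le_idealOrder_iff I y 3).mp hord.ge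
  have hnle : ¬ stalkIdeal I y ≤ IsLocalRing.maximalIdeal (Y.presheaf.stalk y) ^ 4 := by
    intro h
    have h1 := (le_idealOrder_iff I y 4).mpr h
    rw [hord] at h1
    exact absurd (ENat.coe_le_coe.mp h1) (by omega)
  obtain ⟨h, hhI, hh4⟩ : ∃ h ∈ stalkIdeal I y, h ∉ IsLocalRing.maximalIdeal (Y.presheaf.stalk y) ^ 4 := by
    by_contra hcon
    push Not at hcon
    exact hnle hcon
  have hh3 : h ∈ IsLocalRing.maximalIdeal (Y.presheaf.stalk y) ^ (2 + 1) := hle hhI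
  have hh4' : h ∉ IsLocalRing.maximalIdeal (Y.presheaf.stalk y) ^ (2 + 2) := hh4
  have hp3' : ¬ p ∣ 2 + 1 := fun hd => hp3 ((Nat.prime_dvd_prime_iff_eq hp Nat.prime_three).mp hd)
  letI := stalkAlgebra φ y
  obtain ⟨D, hD, hz⟩ := hH p hp k Y g hB y hy hsep 2 h hh3 hh4' hp3'
  set J : Y.IdealSheafData := diffIdealSheaf φ 2 I with hJ
  have hzJ : D h ∈ stalkIdeal J y := by
    rw [hJ, stalkIdeal_diffIdealSheaf hft]
    exact apply_mem_diffIdeal k hD hhI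
  have hz1 := (adicOrder_eq_one_iff (D h)).mp hz
  have hJ2 : ¬ stalkIdeal J y ≤ IsLocalRing.maximalIdeal (Y.presheaf.stalk y) ^ 2 := fun hle2 => hz1.2 (hle2 hzJ)
  obtain ⟨U', hU', hyU', -⟩ := exists_isAffineOpen_mem_and_subset (X := Y) (x := y) (U := ⊤) (Opens.mem_top y)
  set U : Y.affineOpens := ⟨U', hU'⟩
  obtain ⟨u, huJ, hu2⟩ := exists_section_germ_not_mem_sq J hJ2 U hyU'
  have hyJ : y ∈ J.support := by
    rw [hJ]
    exact mem_support_diffIdealSheaf_of_le_idealOrder hft I (by rw [hord])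
  have hum : (Y.presheaf.germ U y hyU').hom u ∈ IsLocalRing.maximalIdeal (Y.presheaf.stalk y) := by
    have h1 : (Y.presheaf.germ U y hyU').hom u ∈ stalkIdeal J y := by
      rw [stalkIdeal_eq_map_germ J U hyU']
      exact Ideal.mem_map_of_mem _ huJ
    exact (mem_support_iff_stalkIdeal_le J y).mp hyJ h1
  exact ⟨U, hyU', u, huJ, hum, hu2⟩

/-- **`NoSepCoreOff3`** — «over ANY field of characteristic `p ≠ 3`, a base of the class carries NO core point
of marking 3 at a closed
point with separable residue field».  DECIDED IN KERNEL (rev1 `noSepCoreOff3`; rev0 `noSepCoreOff3_of_port`); its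
perfect-field sub-case is g14's PROVED `NoCoreOff3Perf`. -/
def NoSepCoreOff3 : Prop :=
  ∀ p : ℕ, p.Prime → p ≠ 3 → ∀ (k : Type) [Field k] [CharP k p] (Y : Scheme.{0})
    (g : Y ⟶ Spec (.of k)) (hB : IsBase Y g) (I : Y.IdealSheafData) (y : Y),
      IsClosed ({y} : Set Y) → SepResidueAt g y → ¬ IsCorePt g hB.isRegular I 3 y

/-- **kernel (PROVED mod the lemma; outright below)**. (Sources: VillamayorU2008ReesDiff, §4.1 and Remark 4.3.) -/
theorem noSepCoreOff3_of_port (hH : HSPortSepResidue) : NoSepCoreOff3 := by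
  intro p hp hp3 k _ _ Y g hB I y hy hsep hcore
  exact hcore.2 (Or.inr (Or.inl (isContactPt_of_idealOrder_eq_three_of_sep hH hp hp3 g hB I hy hsep hcore.1)))

/-- **kernel (PROVED, rev1): `NoSepCoreOff3` outright.** [folklore] -/
theorem noSepCoreOff3 : NoSepCoreOff3 := noSepCoreOff3_of_port hsPortSepResidue

end Summit.ResolutionOfSingularities.ResolutionOfSingularities.Theorems.AbsoluteContactClasses
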